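import Summits.HodgeConjecture.HodgeConjecture.Theorems.HeckePrymWeilWeilTenfoldsSqrtMinus11WeilSectionGAction
import Summits.HodgeConjecture.HodgeConjecture.Theorems.HeckePrymWeilHyperbolicEightfoldsSqrtMinus7OfAnchorObject
import HarnessLib

/-!
# `WeilTenfoldsSqrtMinus11` by the Perry route, POLARISED BET + ROUTE-ITEM FAMILY (item stmt-HodgeConjecture-1262, route HeckePrymWeil)

Line `quaternionic-norm-anchors` of crux `HeckePrymWeil.WeilTenfoldsSqrtMinus11` (Hodge–Weil classes of every
complex abelian TENFOLD `A` with `φ ≫ φ = -11`, `K = ℚ(√-11)`, type `(5,5)`, are algebraic), skeleton v3 (lead c3,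
2026-08-17, stub `stub_perryRouteCompositionPol`): the composition of the line with TWO CHANGES OF TYPING with
respect to the landed v2.1 file `Theorems/HeckePrymWeilWeilTenfoldsSqrtMinus11TensorAnchorPerryFull`
(`stub_perryRouteCompositionFull`, p129437):

1. THE BET IS POLARISED. v2/v2.1 asked for a semiregular finite locally free `E₀` at the tensor-isogenous anchor
   with WEIL-PURE Chern character `ch(E₀) = r₀·1 + r·x₀`; that typing is believed FALSE for every semiregular
   `E₀` (cross-crux note of the strategist of stmt-1260, accepted by lead c2, `Cruxes/…/TensorAnchorDesign.md` §7:
   `1` and the Weil plane stay Hodge along the unpolarised `K`-torus germ, so Buchweitz–Flenner relative smoothness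
   deforms `E₀` to the generic `K`-torus, where Bogomolov–Bando–Siu with `ch₂ = 0` forces `ch = rank`).  Every
   honest witness (c2's line-bundle designs at the CM anchor, Markman's secant sheaves) has `ch ∈ ℚ[θ] ⊕ W`.  So
   hypothesis 4 below allows POLARIZATION POWERS: `ch_k(E₀) = q_k·θ^k` (`k ≠ 5`), `ch₅(E₀) = q₅·θ⁵ + r·x`,
   `r ∈ ℚˣ`, where `θ = 11·ι^*a + Ψ^*ι^*a` is the `K`-SYMMETRISED hyperplane class of ANY projective embedding
   `ι : Y ↪ ℙᴺ` of the anchor and any non-zero rational `a ∈ H²(ℙᴺ)` (the route's own polarization typing, cf.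
   `IsHyperbolicWeilType` in `Theses/HeckePrymWeil.lean`; sibling precedent at a hyperbolic anchor:
   `Theorems/HeckePrymWeilHyperbolicEightfoldsSqrtMinus7OfAnchorObject`, whose general-`n` engine
   `AnchorObject.engine_of_perry` this file IMPORTS and reuses at `n = 5`).
2. THE FAMILY IS THE ROUTE ITEM. Hypothesis 1 is the route crux `HeckePrymWeil.DeligneWeilFamily`
   (stmt-HodgeConjecture-16866) BY NAME (route-choice advisory of 2026-08-16T22:21Z on the item), consumed through
   the landed `deligneWeilFamilyDecl_iff_kAction` and `deligne1982_weilFamily_globalAction_of_kAction`; the total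
   space `√-11`, `g : 𝒳 ⟶ 𝒳`, is KEPT (it builds the global `K`-symmetrised class `11·Θ + g^*Θ`), which is why
   the package `hodgeWeilSectionG_of_globalAction` (PART 1, `Theorems/…WeilTenfoldsSqrtMinus11WeilSectionGAction`) re-derives the fibrewise-Hodge flat Weil section with
   the action clauses retained (proof verbatim `deligne1982_weilFamily_hodgeWeilSection_of_globalAction`).

Hypotheses of `stub_perryRouteCompositionPol` (CONDITIONAL result; nothing is asserted):
1. `Summit.HodgeConjecture.HodgeConjecture.Theses.HeckePrymWeil.DeligneWeilFamily` (route crux, by name);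
2. `HodgeTheory.Perry2026_semiregularFull_remainsAlgebraic` (named claim-fact, by name);
3. `Nonempty HodgeTheory.StandardChernCharacterBetti` (construction debt);
4. THE POLARISED BET `stub_tensorAnchorObjectPol` of skeleton v3, spelled out verbatim as the hypothesis `hB`
   (no `def` is introduced: this file is theorems only).

MECHANISM (`stub_perryRouteCompositionPol`, concluding the crux BY NAME). Given `(A, φ)` and a non-zero rational
`(5,5)` class `c` of the typed plane: upgrade to the strong plane (`stub_upgrade`, landed); hypothesis 1 gives the
family `f : 𝒳 → S` through `e : A ≅ 𝒳_{s₁}` with `g`, the continuous Weil section `σ` through `c`, fibrewise Hodge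
(package of PART 1), rational along `σ` (`stub_rationalAlongSection`, landed), globalised to `W ∈ H¹⁰(𝒳)` by the PROVED
Leray engine (`stub_globalClassOfSection_of_leray deligne1968_invariantClass_fromTotalSpace_holds`), and the anchor
`e₀ : Y ≅ 𝒳_{s₀}` with `σ(s₀)` in the strong Weil plane of `(Y, Ψ)` and `σ(s₀) ≠ 0` (identity principle,
`gcs_section_eq_of_eq`, landed); the fibres embed in one `ℙᵐ` by `ε` (`exists_forall_isClosedImmersion_fiberι_comp`),
`m ≥ 10 ≥ 1` (`dim_le_of_isClosedImmersion_projectiveSpace`), so a non-zero rational `a ∈ H²(ℙᵐ)` exists and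
`Θ_K := 11·ε^*a + g^*ε^*a` is a GLOBAL class with rational `(1,1)` fibre restrictions `11·θ_s + g_s^*θ_s`; at `s₀`
it is `e₀`-transported to the bet's `θ` for the embedding `e₀ ≫ ι_{s₀} ≫ ε` of `Y`; hypotheses 3–4 give `E₀` on
`𝒳_{s₀}`; `engine_of_perry` (hypothesis 2) makes `q₅·Θ_K|_{s₁}⁵ + r·W|_{s₁}` algebraic; `Θ_K|_{s₁}⁵` is algebraic on
the abelian `A ≅ 𝒳_{s₁}` (Lefschetz `(1,1)`, DISCHARGED `lefschetzOneOne_rational_holds`, and Kleiman,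
`cupPowTwo_mem_algebraicClasses_abelian`); hence `r·e^{-1*}c`, hence `c`, is algebraic (`IsoInvariance`, proved).
No one-class-suffices and no isogeny descent are needed: the family passes through `A` and `c` themselves.
-/
noncomputable section

-- single-problem summit (Problem = Summit): the mandated namespace repeats `HodgeConjecture`.
set_option linter.dupNamespace false

open CategoryTheory AlgebraicGeometry Limits MonoidalCategory CartesianMonoidalCategory
open Literature.AlgebraicGeometry Literature.AlgebraicGeometry.Motives
  Literature.AlgebraicGeometry.HodgeTheory
open Literature.AlgebraicTopology.SingularHomology
open Summit.HodgeConjecture.HodgeConjecture.Theorems.HeckePrymWeilLine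
  (stub_upgrade stub_rationalAlongSection gcs_section_eq_of_eq owf_isoTransport
    stub_globalClassOfSection_of_leray deligneWeilFamilyDecl_iff_kAction)
open Summit.HodgeConjecture.HodgeConjecture.Theorems.HyperbolicEightfoldsSqrtMinus7.AnchorObject
  (engine_of_perry complexBetti_map_cupPowTwo cupPowTwo_mem_algebraicClasses_abelian)

namespace Summit.HodgeConjecture.HodgeConjecture.Theorems.WeilTenfoldsSqrtMinus11.TensorAnchorPerryPol

/-! ## The composition: route item + Perry + Chern character + polarised bet ⟹ the crux, BY NAME -/

/-- **`WeilTenfoldsSqrtMinus11` from the route item `DeligneWeilFamily`, Perry's theorem (full semiregularity), a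
standard Chern character and the POLARISED anchor object** (the line's composition, skeleton v3; CONDITIONAL —
nothing is asserted, the four hypotheses are the four registered stubs).  See the module docstring for the
mechanism. [cite: Deligne1982HodgeCycles, proof of Thm. 4.8 (pp. 47–52) with Prop. 4.4]
[cite: Perry2026Semiregularity, Thm. 1.1 (2)] [cite: VoisinHodgeII2003, Thm. 4.18 and §9.2.4 Prop. 9.20]
[cite: Markman2025SecantWeil, §1.5]

HYPOTHESIS `hB` — **THE POLARISED BET** (skeleton v3, registered `stub_tensorAnchorObjectPol`): a SEMIREGULAR
VECTOR BUNDLE WITH POLARISED WEIL CHARGE ON EVERY TENSOR-ISOGENOUS `√-11` TENFOLD: for every standard Chern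
character `C`, every abelian tenfold `(Y, Ψ)`, `Ψ ≫ Ψ = -11`, with an isogeny pair `(f₁, g₁, m)` towards a tensor
point `(A₁ × A₁, (x, y) ↦ (-11·y, x))`, `A₁` an abelian fivefold (the special fibre of the route item
`DeligneWeilFamily`: the diagonal CM point `E_K^{10}` of the component, or `A₀ ⊗ K` in the split one), every
projective embedding `ι : Y ↪ ℙᴺ` and non-zero rational `a ∈ H²(ℙᴺ)` — giving the `K`-SYMMETRISED hyperplane class
`θ = 11·ι^*a + Ψ^*ι^*a` (a `K`-compatible polarization class up to `ℚˣ`) — and every non-zero rational `(5,5)` class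
`x` of the strong Weil plane `weilClassesOf Y Ψ 5 11`, there is, on every `ℂ`-scheme `F₀ ≅ Y` (the fibre through
`e₀`; Perry's theorem needs the object ON the fibre), a finite locally free SEMIREGULAR (`IsISemiregular hE₀ Set.univ`,
the full Buchweitz–Flenner map injective) `E₀` with `ch_k(E₀) = q_k·θ^k` (`k ≠ 5`) and `ch₅(E₀) = q₅·θ⁵ + r·x`,
`r ∈ ℚˣ`, transported along `e₀`.  WHY PLAUSIBLY TRUE / THE WORK: the class exists in `K₀ ⊗ ℚ` (Weil classes are
algebraic on `Y`, `owf_anchorAlgebraic`; `ch : K₀ ⊗ ℚ ≅ CH ⊗ ℚ`), so the content is SEMIREGULARITY of a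
representative, now with the polarization powers every honest witness carries: at the CM anchor `E_K^{10}` lead
c2's direct sums of line bundles `⊕ L_{H_t}` with `Σ_t ch(L_{H_t}) ∈ ℚ[θ] ⊕ W` (`TensorAnchorDesign.md` §§2–6:
the K-class exists explicitly; semiregularity = pairwise Mumford-index avoidance + one exact injectivity, cap
`T ≤ 2799`; reduced to ten points of the norm-one torus `K¹` with `p₁ = p₃ = 0 ≠ p₅`), or a genuinely non-split
object at `A₁ × A₁` (Markman's secant sheaves, `n ≤ 3` in print).  WHY IT MIGHT FAIL: no semiregular sheaf with
non-zero Weil charge is known on any abelian variety of dimension `≥ 8` ([Markman2025SecantWeil, §1.2]); the bet is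
asked for EVERY `K`-compatible very ample `θ` and EVERY rational direction `x` (designs give a cone of directions per
polarization).  The Weil-PURE sub-case (`q = 0`) is the refuted v2.1 typing and is NOT claimed separately.
[cite: Markman2025SecantWeil, §1.2 and Thm. 1.5.1] [cite: BuchweitzFlenner2003, Def. 4.1 and Thm. 5.1]
[cite: Perry2026Semiregularity, Def. 2.4 and Thm. 1.1 (2)] -/
theorem stub_perryRouteCompositionPol : Summit.HodgeConjecture.HodgeConjecture.Theses.HeckePrymWeil.DeligneWeilFamily → Perry2026_semiregularFull_remainsAlgebraic → Nonempty StandardChernCharacterBetti → (∀ (C : StandardChernCharacterBetti) (Y : AbelianVariety ℂ) (Ψ : Y ⟶ Y) (A₁ : AbelianVariety ℂ) (f₁ : Y ⟶ A₁.prod A₁) (g₁ : A₁.prod A₁ ⟶ Y) (m : ℕ), A₁.dim = 5 → Y.dim = 10 → Ψ ≫ Ψ = -((11 : ℤ) • 𝟙 Y) → 0 < m → f₁ ≫ g₁ = m • 𝟙 Y → AlgebraicGeometry.Flat f₁.hom.hom.hom.left → g₁ ≫ Ψ = AbelianVariety.prodLift (AbelianVariety.snd A₁ A₁ ≫ (-((11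 : ℤ) • 𝟙 A₁))) (AbelianVariety.fst A₁ A₁) ≫ g₁ → ∀ (ι : ProjectiveEmbedding Y.X) (a : complexBetti (projectiveSpace ι.n ℂ) 2), IsRationalClass a → a ≠ 0 → ∀ (x : complexBetti Y.X (2 * 5)), IsRationalClass x → IsOfHodgeType 10 Y.X (2 * 5) 5 5 x → x ∈ weilClassesOf Y Ψ 5 11 → x ≠ 0 → ∀ (F₀ : SchemeOver ℂ) (e₀ : Y.X ≅ F₀), ∃ (E₀ : F₀.left.Modules) (hE₀ : IsFiniteLocallyFree E₀) (q : ℕ → ℚ) (r : ℚ), r ≠ 0 ∧ IsISemiregular hE₀ Set.univ ∧ (∀ k : ℕ, k ≠ 5 → C.ch F₀ E₀ k = ((q k : ℚ) : ℂ) • complexBetti.map e₀.inv (2 * k) (cupPowTwo ((11 : ℂ) • complexBetti.map ι.ι 2 a + complexBetti.map Ψ.hom.hom.hom 2 (complexBetti.map ι.ι 2 a)) k)) ∧ C.ch F₀ E₀ 5 = complexBetti.map e₀.inv (2 * 5) (((q 5 : ℚ) : ℂ) • cupPowTwo ((11 : ℂ) • complexBetti.map ι.ι 2 a + complexBetti.map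 Ψ.hom.hom.hom 2 (complexBetti.map ι.ι 2 a)) 5 + ((r : ℚ) : ℂ) • x)) → Summit.HodgeConjecture.HodgeConjecture.Theses.HeckePrymWeil.WeilTenfoldsSqrtMinus11 := by
  intro hF hP hC hB A φ hA hφ c hr hH hW
  by_cases hc : c = 0
  · rw [hc]
    exact Submodule.zero_mem _
  -- casts: the packages are stated for a variable prime `p`, here `p = 11`, at degree `2 * 5`
  have hφ' : φ ≫ φ = -(((11 : ℕ) : ℤ) • 𝟙 A) := by exact_mod_cast hφ
  have hA' : A.dim = 2 * 5 := hA
  -- typing upgrade (landed): the single-operator plane lies in the strong Weil plane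
  have hcW : c ∈ weilClassesOf A φ 5 11 := by
    refine stub_upgrade 11 (by norm_num) (by norm_num) (by norm_num) 5 A φ hA' hφ' ?_
    exact_mod_cast hW
  -- the route item, as the abelian scheme with `K`-action (landed equivalences), with the action KEPT
  have hK : deligne1982_weilFamily_kAction := deligneWeilFamilyDecl_iff_kAction.mp hF
  have hG : deligne1982_weilFamily_globalAction := deligne1982_weilFamily_globalAction_of_kAction hK
  obtain ⟨𝒳, S, f, g, s₁, s₀, e, σ, hfam, hemb, hirr, hsm, hSqp, hg, hfib, he, hσc, hpt, hHσ, hs₁, Y, Ψ,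
    e₀, x, ⟨A₁, f₁, g₁, m, hA₁, hY, hΨ, hm, hfg, hf₁, hg₁⟩, he₀, hs₀, hx⟩ :=
    hodgeWeilSectionG_of_globalAction hG 11 (by norm_num) (by norm_num) (by norm_num) 5 (by norm_num) A φ hA'
      hφ' c hcW hc hr hH
  -- rationality along the section (landed)
  have hrat₁ : IsRationalClass (σ s₁).cls := by
    rw [hs₁]; exact hr.map _
  have hratσ : ∀ s, IsRationalClass (σ s).cls :=
    stub_rationalAlongSection f (2 * 5) (2 * 5) hfam hsm hSqp hirr σ hσc hpt s₁ hrat₁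
  have hratx : IsRationalClass x := by
    have h := hratσ s₀
    rwa [hs₀] at h
  have hHx : IsOfHodgeType 10 (fiberOver f s₀) (2 * 5) 5 5 x := by
    have h := hHσ s₀
    rw [hs₀] at h
    exact h
  -- the base is a connected manifold; `R• f_* ℂ` is a local system on it
  haveI := hsm
  haveI := hirr
  haveI : LocallyOfFiniteType S.hom := hSqp.locallyOfFiniteType
  haveI : ConnectedSpace (ComplexPoints S) :=
    (ComplexPoints.connectedSpace_iff_holds S).2 inferInstance
  obtain ⟨dS, hdS⟩ := exists_smoothOfRelativeDimension_of_connectedSpace_complexPoints S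
  haveI := hdS
  haveI := pathConnectedSpace_complexPoints_of_smoothOfRelativeDimension S dS
  have hU := isCohomologicallyLocallyTrivialOn_univ_of_isSmoothProjectiveFamily f dS hfam hSqp
  -- `x ≠ 0`: a continuous section vanishing at `s₀` vanishes identically (identity principle, landed)
  have hx0 : x ≠ 0 := by
    intro hx0
    have hzero : σ s₀ = globalSection f (2 * 5) 0 s₀ := by
      rw [hs₀, hx0]
      show (⟨s₀, 0⟩ : FiberClass f (2 * 5)) = ⟨s₀, _⟩
      rw [map_zero]
    have hall := gcs_section_eq_of_eq f (2 * 5) hU hσc hpt (continuous_globalSection f _ 0)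
      (fun _ => rfl) hzero s₁
    rw [hs₁] at hall
    have hc' : complexBetti.map e.inv (2 * 5) c = 0 := by
      have h2 := ((FiberClass.clsAt_eq_iff _ rfl _).2 hall.symm).symm
      rw [h2]
      show complexBetti.map (fiberι f s₁) (2 * 5) 0 = 0
      rw [map_zero]
    apply hc
    have h3 := congrArg (complexBetti.map e.hom (2 * 5)) hc'
    rwa [map_zero, ← CategoryTheory.comp_apply, ← complexBetti.map_comp, Iso.hom_inv_id,
      complexBetti.map_id, CategoryTheory.id_apply] at h3
  -- the PROVED Leray engine: `σ` is the restriction of a global class `W`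
  obtain ⟨W, hWσ⟩ := stub_globalClassOfSection_of_leray deligne1968_invariantClass_fromTotalSpace_holds f (2 * 5)
    (2 * 5) hfam hemb hsm hSqp hirr σ hσc hpt
  have hcls : ∀ (s : ComplexPoints S) (y : complexBetti (fiberOver f s) (2 * 5)),
      σ s = ⟨s, y⟩ → complexBetti.map (fiberι f s) (2 * 5) W = y := by
    intro s y hy
    have h := (hWσ s).symm.trans hy
    simp only [globalSection, FiberClass.mk.injEq, heq_eq_eq, true_and] at h
    exact h
  have hW₁ : complexBetti.map (fiberι f s₁) (2 * 5) W = complexBetti.map e.inv (2 * 5) c := hcls s₁ _ hs₁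
  have hW₀ : complexBetti.map (fiberι f s₀) (2 * 5) W = x := hcls s₀ x hs₀
  have hWrat : ∀ s, IsRationalClass (complexBetti.map (fiberι f s) (2 * 5) W) := by
    intro s
    have h := hratσ s
    rw [hWσ s] at h
    exact h
  have hWH : ∀ s, IsOfHodgeType (2 * 5) (fiberOver f s) (2 * 5) 5 5 (complexBetti.map (fiberι f s) (2 * 5) W) := by
    intro s
    have h := hHσ s
    rw [hWσ s] at h
    exact h
  -- the fibre maps of `g`
  have hgf' := fun t ↦ exists_fiberHom_comp_fiberι f g hg t
  choose gf hgf using hgf'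
  -- all fibres embed in ONE projective space `ℙᵐ`, `m ≥ 10`
  obtain ⟨mm, ε, hε⟩ := exists_forall_isClosedImmersion_fiberι_comp f hfam hemb hSqp
  have hPm : IsSmoothProjective mm (projectiveSpace mm ℂ) := isSmoothProjective_projectiveSpace' mm
  have hmm : 1 ≤ mm := by
    haveI := hε s₀
    obtain ⟨B⟩ := (nonempty_hodgeModel_holds (n := 2 * 5) (X := fiberOver f s₀)).nonempty
      (hfam.isSmoothProjective s₀)
    obtain ⟨Bm⟩ := (nonempty_hodgeModel_holds (n := mm) (X := projectiveSpace mm ℂ)).nonempty hPm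
    have h := dim_le_of_isClosedImmersion_projectiveSpace (hfam.isSmoothProjective s₀) (fiberι f s₀ ≫ ε) B Bm
    omega
  obtain ⟨a, ha, ha0⟩ := exists_isRationalClass_ne_zero_projectiveSpace hmm
  have ha11 : IsOfHodgeType mm (projectiveSpace mm ℂ) (2 * 1) 1 1 a :=
    isOfHodgeType_of_mem_algebraicClasses_of_isSmoothProjective hPm 1
      (by rw [algebraicClasses_projectiveSpace_eq_top]; exact Submodule.mem_top)
  -- the GLOBAL `K`-symmetrised hyperplane class `Θ_K = 11·ε^*a + g^*ε^*a` and its fibre restrictions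
  set Θ : complexBetti 𝒳 2 := complexBetti.map ε 2 a with hΘdef
  set ΘK : complexBetti 𝒳 2 := (11 : ℂ) • Θ + complexBetti.map g 2 Θ with hΘKdef
  -- `θ_s := ι_s^* Θ = (ι_s ≫ ε)^* a`
  have hθs : ∀ s, complexBetti.map (fiberι f s) 2 Θ = complexBetti.map (fiberι f s ≫ ε) 2 a := by
    intro s
    rw [hΘdef, complexBetti.map_comp, ModuleCat.comp_apply]
  have hΘKs : ∀ s, complexBetti.map (fiberι f s) 2 ΘK =
      (11 : ℂ) • complexBetti.map (fiberι f s) 2 Θ +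
        complexBetti.map (gf s) 2 (complexBetti.map (fiberι f s) 2 Θ) := by
    intro s
    rw [hΘKdef, map_add, map_smul, ← ModuleCat.comp_apply (complexBetti.map g 2),
      ← complexBetti.map_comp, ← hgf s, complexBetti.map_comp, ModuleCat.comp_apply]
  -- `Θ_K|_{𝒳_s}` is rational of type `(1,1)` on every fibre
  have hΘKfib : ∀ s, IsRationalClass (complexBetti.map (fiberι f s) 2 ΘK) ∧
      IsOfHodgeType (2 * 5) (fiberOver f s) 2 1 1 (complexBetti.map (fiberι f s) 2 ΘK) := by
    intro s
    have hsp := hfam.isSmoothProjective s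
    have hrat' : IsRationalClass (complexBetti.map (fiberι f s) 2 Θ) := by
      rw [hθs s]; exact ha.map _
    have h11' : IsOfHodgeType (2 * 5) (fiberOver f s) 2 1 1 (complexBetti.map (fiberι f s) 2 Θ) := by
      rw [hθs s]; exact ha11.map_of_isSmoothProjective hsp hPm _
    rw [hΘKs s]
    refine ⟨?_, (h11'.smul _).add hsp (h11'.map_of_isSmoothProjective hsp hsp _)⟩
    have h11 : ((11 : ℚ) : ℂ) • complexBetti.map (fiberι f s) 2 Θ = (11 : ℂ) • complexBetti.map (fiberι f s) 2 Θ := by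
      norm_num
    rw [← h11]
    exact (hrat'.smul 11).add (hrat'.map _)
  -- the anchor's embedding `Y ≅ 𝒳_{s₀} ↪ ℙᵐ` and the bet's `K`-symmetrised class `θ` through `e₀`
  haveI : IsIso e₀.hom.left :=
    ⟨e₀.inv.left, by rw [← Over.comp_left, e₀.hom_inv_id, Over.id_left],
      by rw [← Over.comp_left, e₀.inv_hom_id, Over.id_left]⟩
  haveI := hε s₀
  haveI : IsClosedImmersion (e₀.hom ≫ (fiberι f s₀ ≫ ε)).left := by
    rw [Over.comp_left]
    infer_instance
  let ιY : ProjectiveEmbedding Y.X := ⟨mm, e₀.hom ≫ (fiberι f s₀ ≫ ε), inferInstance⟩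
  have he₀' : e₀.hom ≫ gf s₀ = Ψ.hom.hom.hom ≫ e₀.hom :=
    hom_comp_fiberHom_eq_of_comp_fiberι f g (hgf s₀) e₀ Ψ.hom.hom.hom he₀
  have hιa : complexBetti.map ιY.ι 2 a = complexBetti.map e₀.hom 2 (complexBetti.map (fiberι f s₀) 2 Θ) := by
    show complexBetti.map (e₀.hom ≫ (fiberι f s₀ ≫ ε)) 2 a = _
    rw [complexBetti.map_comp, ModuleCat.comp_apply, hθs s₀]
  have hθY : complexBetti.map e₀.inv 2
      ((11 : ℂ) • complexBetti.map ιY.ι 2 a + complexBetti.map Ψ.hom.hom.hom 2 (complexBetti.map ιY.ι 2 a)) =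
      complexBetti.map (fiberι f s₀) 2 ΘK := by
    rw [hιa, map_add, map_smul, e₀.complexBetti_map_inv_map_hom, hΘKs s₀]
    congr 1
    rw [← ModuleCat.comp_apply (complexBetti.map e₀.hom 2), ← complexBetti.map_comp,
      ← ModuleCat.comp_apply (complexBetti.map (Ψ.hom.hom.hom ≫ e₀.hom) 2), ← complexBetti.map_comp,
      ← he₀', e₀.inv_hom_id_assoc]
  -- the Weil class read on `Y`
  have hxY0 : complexBetti.map e₀.hom (2 * 5) x ≠ 0 := by
    intro h0
    apply hx0
    have h3 := congrArg (complexBetti.map e₀.inv (2 * 5)) h0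
    rwa [map_zero, e₀.complexBetti_map_inv_map_hom] at h3
  have hxYH : IsOfHodgeType 10 Y.X (2 * 5) 5 5 (complexBetti.map e₀.hom (2 * 5) x) := hHx.map_of_iso e₀
  -- STUB C: a standard Chern character; STUB B: the polarised semiregular object on `𝒳_{s₀} ≅ Y`
  obtain ⟨C⟩ := hC
  obtain ⟨E₀, hE₀, q, r, hr0, hsr, hEk, hE5⟩ :=
    hB C Y Ψ A₁ f₁ g₁ m hA₁ hY (by exact_mod_cast hΨ) hm hfg hf₁ (by exact_mod_cast hg₁) ιY a ha ha0
      (complexBetti.map e₀.hom (2 * 5) x) (hratx.map _) hxYH hx hxY0 (fiberOver f s₀) e₀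
  have hrC : ((r : ℚ) : ℂ) ≠ 0 := by exact_mod_cast hr0
  -- the Chern character of `E₀` in terms of the GLOBAL classes `Θ_K`, `r • W`
  have hk : ∀ k : ℕ, k ≠ 5 →
      C.ch (fiberOver f s₀) E₀ k = ((q k : ℚ) : ℂ) • cupPowTwo (complexBetti.map (fiberι f s₀) 2 ΘK) k := by
    intro k hk5
    rw [hEk k hk5, complexBetti_map_cupPowTwo, hθY]
  have hWrat' : ∀ s, IsRationalClass (complexBetti.map (fiberι f s) (2 * 5) (((r : ℚ) : ℂ) • W)) := by
    intro s
    rw [map_smul]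
    exact (hWrat s).smul r
  have hWH' : ∀ s, IsOfHodgeType (2 * 5) (fiberOver f s) (2 * 5) 5 5
      (complexBetti.map (fiberι f s) (2 * 5) (((r : ℚ) : ℂ) • W)) := by
    intro s
    rw [map_smul]
    exact (hWH s).smul _
  have hn : C.ch (fiberOver f s₀) E₀ 5 =
      ((q 5 : ℚ) : ℂ) • cupPowTwo (complexBetti.map (fiberι f s₀) 2 ΘK) 5 +
        complexBetti.map (fiberι f s₀) (2 * 5) (((r : ℚ) : ℂ) • W) := by
    rw [hE5, map_add, map_smul, map_smul, complexBetti_map_cupPowTwo, hθY, e₀.complexBetti_map_inv_map_hom,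
      map_smul, hW₀]
  -- STUB P through the engine: `q₅·Θ_K|_{s₁}⁵ + r·W|_{s₁}` is algebraic on `𝒳_{s₁}`
  have halg := engine_of_perry hP 5 f hfam hirr hsm hSqp ΘK hΘKfib (((r : ℚ) : ℂ) • W) hWrat' hWH' s₀
    C.toChernCharacterBetti E₀ hE₀ hsr q hk hn s₁
  -- `Θ_K|_{s₁}⁵` is algebraic on `𝒳_{s₁}`: Lefschetz (1,1) (discharged) + Kleiman on the abelian `A ≅ 𝒳_{s₁}`
  have hAsp : IsSmoothProjective (2 * 5) A.X := by
    have h := AbelianVariety.isSmoothProjective_holds (A := A)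
    rw [AbelianVariety.isSmoothProjective, hA'] at h
    exact h
  have hh₁rat : IsRationalClass (complexBetti.map e.hom 2 (complexBetti.map (fiberι f s₁) 2 ΘK)) :=
    (hΘKfib s₁).1.map _
  have hh₁H : IsOfHodgeType (2 * 5) A.X 2 1 1 (complexBetti.map e.hom 2 (complexBetti.map (fiberι f s₁) 2 ΘK)) :=
    (hΘKfib s₁).2.map_of_iso e
  have hh₁alg : complexBetti.map e.hom 2 (complexBetti.map (fiberι f s₁) 2 ΘK) ∈ algebraicClasses A.X 1 :=
    lefschetzOneOne_rational_holds hAsp _ hh₁rat hh₁H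
  have hh₁5 : complexBetti.map e.hom (2 * 5) (cupPowTwo (complexBetti.map (fiberι f s₁) 2 ΘK) 5) ∈
      algebraicClasses A.X 5 := by
    rw [complexBetti_map_cupPowTwo]
    exact cupPowTwo_mem_algebraicClasses_abelian A hh₁alg 4
  have hΘ5 : cupPowTwo (complexBetti.map (fiberι f s₁) 2 ΘK) 5 ∈ algebraicClasses (fiberOver f s₁) 5 :=
    owf_isoTransport _ A e 5 _ hh₁5
  -- hence `r • W_{s₁} = r • e^{-1*} c`, and so `e^{-1*} c` (`r ≠ 0`), is algebraic on `𝒳_{s₁}`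
  have hrW₁alg : ((r : ℚ) : ℂ) • complexBetti.map e.inv (2 * 5) c ∈ algebraicClasses (fiberOver f s₁) 5 := by
    rw [← hW₁, ← map_smul]
    have h := Submodule.sub_mem _ halg (Submodule.smul_mem _ (((q 5 : ℚ) : ℂ)) hΘ5)
    rwa [add_sub_cancel_left] at h
  have h1 : complexBetti.map e.inv (2 * 5) c ∈ algebraicClasses (fiberOver f s₁) 5 :=
    (Submodule.smul_mem_iff _ hrC).mp hrW₁alg
  -- back along `e : A ≅ 𝒳_{s₁}` (the route's proved `IsoInvariance`)
  have key := Theorems.isoInvariance_proof e 5 _ h1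
  rw [← CategoryTheory.comp_apply, ← complexBetti.map_comp, Iso.hom_inv_id, complexBetti.map_id] at key
  exact key

end Summit.HodgeConjecture.HodgeConjecture.Theorems.WeilTenfoldsSqrtMinus11.TensorAnchorPerryPol

end
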